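import Literature.NumberTheory.Automorphic.MirabolicEisensteinResidue
import Literature.NumberTheory.Automorphic.RankinSelbergEisensteinWeight
import HarnessLib

/-!
# The mirabolic Eisenstein series at a real point as the idele-class integral of the Eisenstein weight

Topic `NumberTheory/Automorphic`; namespace `Literature.NumberTheory.Automorphic`. Proof file (theorems
only). The bridge between the complex-analytic currency of the Rankin–Selberg method — the mirabolic
Eisenstein series `E(g, Φ, s) = |det g|^s ∑_{ξ ∈ ℙ(Kⁿ)} ∫_{𝔸ˣ} Φ(t ξ g) |t|^{ns} d×t`
(`mirabolicEisenstein`, a complex number) — and the `[0, ∞]` currency of the real-point method — the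
Eisenstein weight `w_{Φ,σ}(x) = ∑_{v ∈ Kⁿ ∖ 0} Φ(v x) |det x|^σ` (`eisensteinWeight`, an extended
non-negative real): for a real Schwartz–Bruhat `Φ ≥ 0`, a real `σ > 1`, an idele class domain `𝓕`
(a strict fundamental domain of `Kˣ` in `𝔸_Kˣ`) and every `y ∈ GL_n(𝔸_K)`,

  `E(y, Φ, σ) = ∫_𝓕 w_{Φ,σ}((a 1_n) y) dν(a)`   and   `∫_𝓕 w_{Φ,σ}((a 1_n) y) dν(a) < ∞`

(`mirabolicEisenstein_ofReal_eq_toReal_setLIntegral_eisensteinWeight`): `E(y, Φ, σ) = |det y|^σ E(1, Φ(· y), σ)`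
(`mirabolicEisenstein_eq_cpow_mul_mirabolicEisenstein_one`), `E(1, Ψ, σ) = ∫_𝓕 Θ*_Ψ(a) |a|^{nσ} dν`
(`mirabolicEisenstein_one_eq_setIntegral_thetaStar`), `Θ*_Ψ(a) = ∑_{v ≠ 0} Φ((a v) y)`, and
`v ((a 1_n) y) = (a v) y`, `|det ((a 1_n) y)| = |a|ⁿ |det y|`; the finiteness is the unfolded majorant
`setLIntegral_tsum_enorm_mul_lt_top`. This is the pointwise input `E_X(π g) = ∫_𝓕 W((a 1_n) g⁻¹) dν_I` of
the quotient unfolding `RankinSelbergQuotientUnfolding.exists_lintegral_eisensteinLIntegral_mul_eq` for the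
weight `W = w_{Φ,σ}` (Jacquet–Shalika (1981), §4, (4.2)–(4.3); Cogdell (2004), §2.3).

## References

* H. Jacquet, J. A. Shalika, *On Euler products and the classification of automorphic
  representations I*, Amer. J. Math. 103 (1981), §4 [JacquetShalikaAJM1981].
* J. W. Cogdell, *Analytic theory of L-functions for GL_n*, in *An Introduction to the Langlands
  Program* (2004), §2.3 [CogdellAnalyticTheory2004].
-/

noncomputable section

open MeasureTheory Measure NumberField IsDedekindDomain Matrix Set Filter Topology
open scoped ENNReal NNReal ComplexConjugate

namespace Literature.NumberTheory.Automorphic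

open Literature.NumberTheory.GaloisRepresentations (ideleGroup)

section RealPoint

variable {K : Type} [Field K] [NumberField K] {n : ℕ}

/-- `|det ((a 1_n) y)| = |a|ⁿ |det y|`. [folklore] -/
theorem ideleNorm_det_scalar_mul (a : ideleGroup K) (y : GL (Fin n) (AdeleRing (𝓞 K) K)) :
    (IdeleClassGroup.ideleNorm K (Matrix.GeneralLinearGroup.det
        (Matrix.GeneralLinearGroup.scalar (Fin n) a * y)) : ℝ) =
      (IdeleClassGroup.ideleNorm K a : ℝ) ^ n * (IdeleClassGroup.ideleNorm K (Matrix.GeneralLinearGroup.det y) : ℝ) := by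
  have hdet : Matrix.GeneralLinearGroup.det (Matrix.GeneralLinearGroup.scalar (Fin n) a) = a ^ n := by
    ext
    rw [Matrix.GeneralLinearGroup.val_det_apply, Matrix.GeneralLinearGroup.coe_scalar, Matrix.scalar_apply,
      Matrix.det_diagonal, Finset.prod_const, Finset.card_univ, Fintype.card_fin, Units.val_pow_eq_pow_val]
  rw [map_mul, map_mul, hdet, map_pow, NNReal.coe_mul, NNReal.coe_pow]

/-- **The Eisenstein weight at `(a 1_n) y`**: `w_{Φ,σ}((a 1_n) y) = (∑_{v ≠ 0} Φ((a v) y)) · (|a|ⁿ |det y|)^σ`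
as a product in `[0, ∞]` (all terms non-negative for `Φ ≥ 0`). [folklore] -/
theorem eisensteinWeight_scalar_mul {Φ : (Fin n → AdeleRing (𝓞 K) K) → ℝ} (hΦ0 : ∀ x, 0 ≤ Φ x) (σ : ℝ)
    (a : ideleGroup K) (y : GL (Fin n) (AdeleRing (𝓞 K) K)) :
    eisensteinWeight n K Φ σ (Matrix.GeneralLinearGroup.scalar (Fin n) a * y) =
      (∑' v : {v : Fin n → K // v ≠ 0},
          ENNReal.ofReal (Φ (((a : AdeleRing (𝓞 K) K) • ratVec K v.1) ᵥ*
            (y : Matrix (Fin n) (Fin n) (AdeleRing (𝓞 K) K))))) *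
        ENNReal.ofReal (((IdeleClassGroup.ideleNorm K a : ℝ) ^ n *
          (IdeleClassGroup.ideleNorm K (Matrix.GeneralLinearGroup.det y) : ℝ)) ^ σ) := by
  rw [eisensteinWeight_apply, ← ENNReal.tsum_mul_right]
  refine tsum_congr fun v => ?_
  rw [vecMul_scalar_mul, ← Matrix.smul_vecMul, ideleNorm_det_scalar_mul, ENNReal.ofReal_mul (hΦ0 _)]

variable [MeasurableSpace (AdeleRing (𝓞 K) K)] [BorelSpace (AdeleRing (𝓞 K) K)]
variable (ν : Measure (ideleGroup K)) [ν.IsHaarMeasure]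

/-- **The mirabolic Eisenstein series at a real point is the idele-class integral of the Eisenstein
weight.** For a real `Φ ≥ 0` with `Φ ∈ 𝒮(𝔸_Kⁿ)`, a real `σ > 1`, an idele class domain `𝓕` and
`y ∈ GL_n(𝔸_K)`:
`∫_𝓕 w_{Φ,σ}((a 1_n) y) dν(a) < ∞` and `E(y, Φ, σ) = ∫_𝓕 w_{Φ,σ}((a 1_n) y) dν(a)` (the left side a
complex number, the right side the real number it equals). (Jacquet–Shalika (1981), §4, (4.2)–(4.3);
Cogdell (2004), §2.3.) [cite: JacquetShalikaAJM1981, §4] -/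
theorem mirabolicEisenstein_ofReal_eq_toReal_setLIntegral_eisensteinWeight {𝓕 : Set (ideleGroup K)}
    (h𝓕 : IsIdeleClassDomain K 𝓕) {Φ : (Fin n → AdeleRing (𝓞 K) K) → ℝ}
    (hΦ : (fun x => (Φ x : ℂ)) ∈ piSchwartzBruhat K (Fin n)) (hΦ0 : ∀ x, 0 ≤ Φ x) {σ : ℝ} (hσ : 1 < σ)
    (y : GL (Fin n) (AdeleRing (𝓞 K) K)) :
    (∫⁻ a in 𝓕, eisensteinWeight n K Φ σ (Matrix.GeneralLinearGroup.scalar (Fin n) a * y) ∂ν) < ⊤ ∧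
      mirabolicEisenstein K ν (fun x => (Φ x : ℂ)) (σ : ℂ) y =
        ((∫⁻ a in 𝓕, eisensteinWeight n K Φ σ (Matrix.GeneralLinearGroup.scalar (Fin n) a * y) ∂ν).toReal : ℂ) := by
  haveI := borelSpace_ideleGroup K
  -- the translated Schwartz–Bruhat function `Ψ = Φ(· y)` and the real series `T(a) = ∑_{v ≠ 0} Φ((a v) y)`
  set Ψ : (Fin n → AdeleRing (𝓞 K) K) → ℂ :=
    fun x => (Φ (x ᵥ* (y : Matrix (Fin n) (Fin n) (AdeleRing (𝓞 K) K))) : ℂ) with hΨ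
  have hΨS : Ψ ∈ piSchwartzBruhat K (Fin n) := comp_vecMul_mem_piSchwartzBruhat hΦ y
  set T : ideleGroup K → ℝ := fun a => ∑' v : (({0} : Set (Fin n → K))ᶜ : Set (Fin n → K)),
    Φ (((a : AdeleRing (𝓞 K) K) • ratVec K (v : Fin n → K)) ᵥ* (y : Matrix (Fin n) (Fin n) (AdeleRing (𝓞 K) K)))
    with hT
  set q : ℝ := (IdeleClassGroup.ideleNorm K (Matrix.GeneralLinearGroup.det y) : ℝ) with hq
  have hq0 : 0 ≤ q := NNReal.coe_nonneg _
  -- summability of the real series and its terms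
  have hterm0 : ∀ (a : ideleGroup K) (v : Fin n → K),
      0 ≤ Φ (((a : AdeleRing (𝓞 K) K) • ratVec K v) ᵥ* (y : Matrix (Fin n) (Fin n) (AdeleRing (𝓞 K) K))) :=
    fun a v => hΦ0 _
  have hsum : ∀ a : ideleGroup K, Summable fun v : (({0} : Set (Fin n → K))ᶜ : Set (Fin n → K)) =>
      Φ (((a : AdeleRing (𝓞 K) K) • ratVec K (v : Fin n → K)) ᵥ* (y : Matrix (Fin n) (Fin n) (AdeleRing (𝓞 K) K))) := by
    intro a
    have h := (summable_norm_theta_term hΨS a).subtype (({0} : Set (Fin n → K))ᶜ : Set (Fin n → K))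
    refine h.congr fun v => ?_
    simp only [Function.comp_apply, hΨ, Complex.norm_real, Real.norm_of_nonneg (hterm0 a v)]
  have hT0 : ∀ a, 0 ≤ T a := fun a => tsum_nonneg fun v => hterm0 a v
  -- `Θ*_Ψ(a) = T(a)` as a complex number
  have hθ : ∀ a : ideleGroup K, thetaStar K Ψ a = (T a : ℂ) := by
    intro a
    rw [hT]
    simp only []
    rw [Complex.ofReal_tsum]
    rfl
  -- the `[0, ∞]` series: `∑ ofReal = ofReal T`
  have hTenn : ∀ a : ideleGroup K, (∑' v : {v : Fin n → K // v ≠ 0},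
      ENNReal.ofReal (Φ (((a : AdeleRing (𝓞 K) K) • ratVec K v.1) ᵥ*
        (y : Matrix (Fin n) (Fin n) (AdeleRing (𝓞 K) K))))) = ENNReal.ofReal (T a) := by
    intro a
    rw [hT]
    simp only []
    rw [ENNReal.ofReal_tsum_of_nonneg (fun v => hterm0 a _) (hsum a)]
    rfl
  -- the Eisenstein weight along `(a 1_n) y`
  have hpow : ∀ a : ideleGroup K, ((IdeleClassGroup.ideleNorm K a : ℝ) ^ n * q) ^ σ =
      (IdeleClassGroup.ideleNorm K a : ℝ) ^ ((n : ℝ) * σ) * q ^ σ := fun a => by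
    rw [Real.mul_rpow (pow_nonneg (NNReal.coe_nonneg _) _) hq0, ← Real.rpow_natCast,
      ← Real.rpow_mul (NNReal.coe_nonneg _)]
  have hEW : ∀ a : ideleGroup K, eisensteinWeight n K Φ σ (Matrix.GeneralLinearGroup.scalar (Fin n) a * y) =
      ENNReal.ofReal (T a * (IdeleClassGroup.ideleNorm K a : ℝ) ^ ((n : ℝ) * σ)) * ENNReal.ofReal (q ^ σ) := by
    intro a
    rw [eisensteinWeight_scalar_mul hΦ0, hTenn, hpow,
      ENNReal.ofReal_mul (Real.rpow_nonneg (NNReal.coe_nonneg _) _), ← mul_assoc, ← ENNReal.ofReal_mul (hT0 a)]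
  -- the majorant is finite
  have hmaj : ∫⁻ a in 𝓕, ENNReal.ofReal (T a * (IdeleClassGroup.ideleNorm K a : ℝ) ^ ((n : ℝ) * σ)) ∂ν < ⊤ := by
    have h := setLIntegral_tsum_enorm_mul_lt_top ν h𝓕 hΨS hσ
    refine lt_of_le_of_lt (le_of_eq (setLIntegral_congr_fun h𝓕.measurableSet fun a _ => ?_)) h
    rw [ENNReal.ofReal_mul (hT0 a), ← hTenn a]
    congr 1
    refine tsum_congr fun v => ?_
    rw [hΨ]
    simp only []
    rw [← ofReal_norm, Complex.norm_real, Real.norm_of_nonneg (hterm0 a _)]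
  have hEWint : (∫⁻ a in 𝓕, eisensteinWeight n K Φ σ (Matrix.GeneralLinearGroup.scalar (Fin n) a * y) ∂ν) =
      (∫⁻ a in 𝓕, ENNReal.ofReal (T a * (IdeleClassGroup.ideleNorm K a : ℝ) ^ ((n : ℝ) * σ)) ∂ν) *
        ENNReal.ofReal (q ^ σ) := by
    simp_rw [hEW]
    rw [lintegral_mul_const' _ _ ENNReal.ofReal_ne_top]
  have hlt : (∫⁻ a in 𝓕, eisensteinWeight n K Φ σ (Matrix.GeneralLinearGroup.scalar (Fin n) a * y) ∂ν) < ⊤ := by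
    rw [hEWint]
    exact ENNReal.mul_lt_top hmaj ENNReal.ofReal_lt_top
  refine ⟨hlt, ?_⟩
  -- measurability of the real integrand `T(a) |a|^{nσ}`
  have hTm : Measurable T := by
    have h : T = fun a => (thetaStar K Ψ a).re := funext fun a => by rw [hθ a, Complex.ofReal_re]
    rw [h]
    exact Complex.measurable_re.comp (measurable_thetaStar hΨS)
  have hFm : Measurable fun a : ideleGroup K => T a * (IdeleClassGroup.ideleNorm K a : ℝ) ^ ((n : ℝ) * σ) :=
    hTm.mul ((measurable_coe_nnreal_real.comp (continuous_ideleNorm_holds K).measurable).pow_const _)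
  have hF0 : ∀ a, 0 ≤ T a * (IdeleClassGroup.ideleNorm K a : ℝ) ^ ((n : ℝ) * σ) := fun a =>
    mul_nonneg (hT0 a) (Real.rpow_nonneg (NNReal.coe_nonneg _) _)
  -- `E(1, Ψ, σ)` as a real integral
  have hσ' : 1 < ((σ : ℂ)).re := by rwa [Complex.ofReal_re]
  have hE1 : mirabolicEisenstein K ν Ψ (σ : ℂ) 1 =
      ((∫⁻ a in 𝓕, ENNReal.ofReal (T a * (IdeleClassGroup.ideleNorm K a : ℝ) ^ ((n : ℝ) * σ)) ∂ν).toReal : ℂ) := by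
    rw [mirabolicEisenstein_one_eq_setIntegral_thetaStar ν h𝓕 hΨS hσ']
    have hfun : (fun a : ideleGroup K => thetaStar K Ψ a *
        ((IdeleClassGroup.ideleNorm K a : ℝ) : ℂ) ^ ((n : ℂ) * (σ : ℂ))) =
        fun a => ((T a * (IdeleClassGroup.ideleNorm K a : ℝ) ^ ((n : ℝ) * σ) : ℝ) : ℂ) := by
      funext a
      rw [hθ a, ← Complex.ofReal_natCast, ← Complex.ofReal_mul, ← Complex.ofReal_cpow (NNReal.coe_nonneg _),
        ← Complex.ofReal_mul]
    rw [hfun, ← integral_eq_lintegral_of_nonneg_ae (Eventually.of_forall hF0) hFm.aestronglyMeasurable]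
    exact integral_ofReal
  rw [mirabolicEisenstein_eq_cpow_mul_mirabolicEisenstein_one ν _ (σ : ℂ) y, hE1, hEWint,
    ENNReal.toReal_mul, ENNReal.toReal_ofReal (Real.rpow_nonneg hq0 _), ← hq, ← Complex.ofReal_cpow hq0]
  push_cast
  ring

end RealPoint

end Literature.NumberTheory.Automorphic
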